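import Literature.NumberTheory.EllipticCurves.BhargavaShankarSelmerTwoAverageFrontier
import HarnessLib

/-!
# Bhargava–Shankar, eq. (31) (`bhargavaShankar_sum_irredClassCount_asymptotic`) split at its two
# halves: the upper bound (PROVED in the tree) and the lower bound (the uniformity estimate)

Topic `Literature/NumberTheory/EllipticCurves`. SPLIT RECORD (fact-decompose, 2026-08-16) of the
named fact `Literature.NumberTheory.EllipticCurves.bhargavaShankar_sum_irredClassCount_asymptotic`
(`BhargavaShankarCounting.lean`; M. Bhargava, A. Shankar, *Binary quartic forms having bounded
invariants, and the boundedness of the average rank of elliptic curves*, Ann. of Math. (2) 181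
(2015) 191–242 = arXiv:1006.1002, held text v2: §5.4, display (31) with Prop. 5.12 and Lemma 5.16;
published v3: proof of Thm 3.19 with Thm 2.21):
`Σ_{H(E_{A,B}) < X} #{PGL₂(ℚ)-classes of locally soluble irreducible quartics with invariants
(2⁴I(E), 2⁶J(E))} = 2 c_F X^{5/6} + o(X^{5/6})`.

In the source the two halves of (31) have very different price tags (module docstring of
`BhargavaShankarEq31UpperRouteProofs.lean`): the printed sieve (v2 §3.7, proof of Prop. 3.19;
v3 §2.7, proof of Thm 2.21) yields the **upper bound** `limsup ≤` from the count with finitely many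
congruence conditions (v3 Thm 2.12), while the **lower bound** `liminf ≥` needs in addition the
uniformity estimate (v2 Prop. 3.18 = Prop. 5.13, "significantly more difficult", §4; v3 Thm 2.13,
through Bhargava's quantitative Ekedahl sieve [geosieve], [dodqf, Prop. 23] and the
Delone–Evertse bound for cubic Thue equations) and the acceptability of the weights (v3
Prop. 3.18: `p ∤ Δ(f) ⇒ f` is `ℚ_p`-soluble, Hasse–Weil in genus one). As of 2026-08-16 the upper
half (U31) is a THEOREM of the tree, unconditionally (`sum_irredClassCount_le_holds`,
`BhargavaShankarSelmerTwoAverageFrontier.lean`):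
`BinaryQuartic.sum_irredClassCount_le_of_upperCongruenceCount` (`BhargavaShankarUpperSieveAssemblyProofs`)
fed with the upper congruence count `BinaryQuartic.upperCongruenceCount` (v3 Thm 2.12, upper half:
`BhargavaShankarSelmerTwoAverageHolds`, from the proved Thm 2.1 `bhargavaShankar_classCount_holds`)
and the local densities `BinaryQuartic.integral_sievePhi_eq` (v2 Prop. 5.12 with Brumer–Kramer:
`BhargavaShankarLocalSievePhiIntegralProofs`) — this is how Thm 1.1 in `limsup` form and Cor. 1.2
(average rank `≤ 3/2`, `averageRankLE_three_halves_holds`) were discharged. The named fact therefore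
rests on the lower half alone, which this file vendors as
`bhargavaShankar_sum_irredClassCount_ge` ((L31): for every `ε > 0`, eventually
`Σ_{H(E)<X} #{classes} ≥ (2c_F - ε) X^{5/6}`), with the assembly
`bhargavaShankar_sum_irredClassCount_asymptotic_holds_of` = the frontier file's
`bhargavaShankar_sum_irredClassCount_asymptotic_of_lower` (squeeze), whose hypothesis `hL` is the
child verbatim. The child does not restate the parent (one-sided) and is implied by it
(`bhargavaShankar_sum_irredClassCount_ge_of_asymptotic`).

## Authority for minting the child, and why ONE child rather than the four printed pieces

This file is written under the human ruling of 2026-08-16 instituting the librarian mode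
`fact-decompose` (work unit `libsplit-35`, batch 35, `payload.instruction`: "FACT DECOMPOSITION
(librarian, mode fact-decompose; human 2026-08-16 — an explicit exception to D-0027 A7 for THESE
capped facts only)"), which lists `bhargavaShankar_sum_irredClassCount_asymptotic` among the
Literature facts that exhausted the prover budget ($107.5 / 787 turns) and asks for named children
plus a PROVED assembly `…_holds_of`. The accepted frontier file
`BhargavaShankarSelmerTwoAverageFrontier.lean` (2026-08-16) had kept (L31) as a hypothesis `hL`
under D-0026; the present def mints exactly that hypothesis, verbatim, so that the open content of
display (31) is addressable by name (T0 ranking, fact claims) — nothing else changes.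

Why not mint instead the four printed pieces below (items 1–4: the lower congruence count, v3
Thm 2.13, Prop. 3.18, the lower-bound sieve) as M/L-sized children? Because the split shape requires
the glue `Child₁ → … → Childₖ → parent` to be PROVED now, and the glue from items 1–3 to (L31) IS
item 4 — the lower-bound half of the proof of Thm 2.21 (§2.7) together with the passage from
weighted `GL₂(ℤ)`-orbits to `PGL₂(ℚ)`-classes — whose upper-bound twin took the tree
`BhargavaShankarUpperSieveAssemblyProofs` + `…SetReduction/TypeReduction/WeightsProofs`
(≈ 80 kB of Lean); it is not available, so a four-child split would have an unproved assembly. The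
statements of items 1–2 are nevertheless expressible in the tree's vocabulary today (item 1: the
mirror image of `BinaryQuartic.upperCongruenceCount` with `≥ (ν(Ψ)·(8/27)ζ(2) − ε)X^{5/6}` for
weights `Ψ` defined modulo `N`; item 2: `gl2zClassCount {f | ∃ p > M, p² ∣ Δ(f)} X ≤ (C/M)X^{5/6}`
eventually, uniformly in `M`), and a seat taking (L31) should file them as its own first layer.

## What a discharge of (L31) consists of (v3 architecture; nothing of it is in the tree)

1. the LOWER congruence count (v3 Thm 2.12, lower half, weighted form: the mirror image of
   `BinaryQuartic.upperCongruenceCount`, from Thm 2.1 run inside congruence classes with the lower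
   envelopes);
2. the uniformity / tail estimate (v3 Thm 2.13): `N(∪_{p > M} W_p; X) = O(X^{5/6}/(M log M)) +
   O(X^{19/24})`-type bound for `W_p = {p² ∣ Δ}`, from [geosieve, Thm 3.3], [dodqf, Prop. 23], the
   Delone/Evertse bound `≤ 12` (v3 Prop. 2.16);
3. acceptability of `φ = ∏_p φ_p` (v3 Prop. 3.18: for `p > 2` with `p² ∤ Δ(f)`, `f` is
   `ℤ_p`-soluble and `m_p(f) = 1`; the divisibility half is proved in
   `BhargavaShankarEq31FrontierProofs` §4, the solubility half needs Hasse–Weil for `z² = f(x,y)`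
   over `𝔽_p` and Hensel);
4. the lower-bound sieve (v3 §2.7, proof of Thm 2.21, second half) on `V_ℤ^{(0)}, V_ℤ^{(1)},
   V_ℤ^{(2+)}`, and the passage from weighted `GL₂(ℤ)`-orbits to `PGL₂(ℚ)`-classes
   (`n(f) = m(f)` off `O(X^{3/4+ε})` orbits, Lemma 2.4; `BhargavaShankarBigStabilizers`,
   `BhargavaShankarClassWeightsProofs`), with the local densities (F) and the constant bookkeeping
   already in the tree (`eq31_constant`, `hasProd_localFactor`).

## References

* M. Bhargava, A. Shankar, Ann. of Math. (2) 181 (2015) 191–242 = arXiv:1006.1002; v2: §5.4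
  display (31), Props. 5.12–5.13, Thm 5.14, Lemmas 5.15–5.16, §3.7 (proof of Prop. 3.19), §4;
  v3 (= published): Thms 2.12, 2.13, 2.21 (§2.7), Props 3.6, 3.9, 3.18, Thm 3.19.
  [BhargavaShankarAnnals2015]
-/

noncomputable section

open scoped Classical Topology
open Filter Finset

namespace Literature.NumberTheory.EllipticCurves

open BinaryQuartic

/-- **(L31) — the lower half of Bhargava–Shankar's eq. (31)** (held arXiv text v2 §5.4, display
(31) with Prop. 5.12 and Lemma 5.16; published v3, proof of Thm 3.19 with the LOWER-bound half of
Thm 2.21, §2.7: "`liminf_{X→∞} N_φ(V_ℤ^{(i)}; X)/X^{5/6} ≥ …`", which uses the uniformity estimate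
Thm 2.13 and the acceptability Prop. 3.18): in the tree's normalisation (`H(E_{A,B}) =
max(4|A|³, 27B²) < X`, `c_F = heightFamilyConstant` of Lemma 5.15), for every `ε > 0`, eventually
in `X : ℕ`, `Σ_{H(E_{A,B}) < X} #{PGL₂(ℚ)-classes of locally soluble irreducible integral binary
quartic forms with invariants (2⁴·(−3A), 2⁶·(−27B))} ≥ (2 c_F − ε)·X^{5/6}`. Together with the
PROVED upper half (U31) (`sum_irredClassCount_le_holds` of `BhargavaShankarSelmerTwoAverageFrontier`:
`BinaryQuartic.sum_irredClassCount_le_of_upperCongruenceCount` with `BinaryQuartic.upperCongruenceCount`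
and `BinaryQuartic.integral_sievePhi_eq`) this is eq. (31)
(`bhargavaShankar_sum_irredClassCount_asymptotic_holds_of`). NOT proved in the tree: see the module
docstring, items 1–4, for what its printed proof consists of (lower congruence count, v3 Thm 2.13,
Prop. 3.18, the lower-bound sieve).
[cite: BhargavaShankarAnnals2015, §5.4 eq. (31), lower bound (arXiv:1006.1002v2 numbering) = proof of Thm 3.19 with Thm 2.21 (liminf half), Thm 2.13, Prop. 3.18 (published numbering)] -/
def bhargavaShankar_sum_irredClassCount_ge : Prop :=
  ∀ ε : ℝ, 0 < ε → ∀ᶠ X : ℕ in atTop,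
    (2 * heightFamilyConstant - ε) * (X : ℝ) ^ (5 / 6 : ℝ) ≤
      ∑ AB ∈ heightFamilyBelow X,
        (pgl2QClassCount {f : BinaryQuartic ℤ | f.IsLocallySoluble ∧ f.IsIrreducible ∧
            f.I = 2 ^ 4 * (-3 * AB.1) ∧ f.J = 2 ^ 6 * (-27 * AB.2)} : ℝ)

/-- **Assembly of the split: eq. (31) from its lower half (L31)** — one line over the accepted
frontier theorem `bhargavaShankar_sum_irredClassCount_asymptotic_of_lower` (squeeze against the
proved upper half (U31), `sum_irredClassCount_le_holds`).
[cite: BhargavaShankarAnnals2015, §5.4 eq. (31) (arXiv:1006.1002v2 numbering)] -/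
theorem bhargavaShankar_sum_irredClassCount_asymptotic_holds_of
    (hL : bhargavaShankar_sum_irredClassCount_ge) :
    bhargavaShankar_sum_irredClassCount_asymptotic :=
  bhargavaShankar_sum_irredClassCount_asymptotic_of_lower hL

/-- Sanity: (L31) is implied by the named fact (so the split loses nothing) — the frontier file's
`sum_irredClassCount_lower_of_asymptotic`. [cite: BhargavaShankarAnnals2015, §5.4 eq. (31) (arXiv:1006.1002v2 numbering)] -/
theorem bhargavaShankar_sum_irredClassCount_ge_of_asymptotic
    (h31 : bhargavaShankar_sum_irredClassCount_asymptotic) :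
    bhargavaShankar_sum_irredClassCount_ge :=
  sum_irredClassCount_lower_of_asymptotic h31

/-- Hence, with Thm 1.1: **`average_card_selmerTwo` (the limit `= 3`) from (L31) alone**
(`average_card_selmerTwo_of_lower` of the frontier file). [cite: BhargavaShankarAnnals2015, Thm 1.1] -/
theorem average_card_selmerTwo_holds_of_ge (hL : bhargavaShankar_sum_irredClassCount_ge) :
    average_card_selmerTwo :=
  average_card_selmerTwo_of_lower hL

end Literature.NumberTheory.EllipticCurves

end
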